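import Literature.NumberTheory.Automorphic.ArchTorusOrbitalFubiniSmooth         -- ★ (V7)-smooth: `piEquivPiSubtypeProd_symm_apply_dite`, `piUnique_symm_apply_of_eq`; brings ★ (V7) p840257 (h1)(h2)(h4)
import Literature.NumberTheory.Automorphic.ArchLocalTorusOrbitalCompactWall   -- ★ p839953: `isCompact_setOf_exists_conj_circleDiagonal_mem_of_blocks` (per-place properness at a compact wall)
import HarnessLib

/-!
# Fubini for the torus orbital function of `G′_∞ = Π_w G_w` at a torus point that is only PROPER at each place (e.g. a COMPACT wall at one place)
# ((δ8): the compact-wall regular terms of the jump formula as GLOBAL group integrals; Borel–Jacquet §4.1, Rogawski 1990 §8.2–8.3)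

Topic `NumberTheory/Automorphic`; namespace `Literature.NumberTheory.Automorphic.UnitaryGroup`.  THEOREMS ONLY (no `def`, no instance, no notation, no axiom, no `sorry`).
Cell `pub/hodgecm-mathlib`, ENGINE T1 (crux H413 = `stmt-HodgeConjecture-24833`); floor-2 road «(J-nc) in-house», brick (δ8) of R1 `stub_LuseAllPlaces` (LEAD F0P3a-plan (g9)
WORD T8-53 ∕ T8-57; author F0P3a-p07 (g7), 2026-09-01).

WHY.  ★ (V7) Fubini (h2)∕(h4) `integral_comp_conj_archDiagTorus_eq_integral_partial` (p840257) reads the GLOBAL torus orbital integral `∫_{G′_∞} f(g·t(z)·g⁻¹) dν` as the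
`w₀`-torus orbital integral of the partial orbital lambda — under `hz : ∀ w, Injective (z w)` (regular at EVERY place), which it uses only through the global joint
properness ★ `hasCompactSupport_comp_conj_archDiagTorus`.  The jump formula ★ (δ) p840879 needs the same identity at the COMPACT walls of the place `w₀` (the regular
terms `2·∫_{G_{w₀}} PO(x·diag(z⁰_{w₀}∘ρ)·x⁻¹)`, `z⁰_{w₀}` with a repeated eigenvalue in a DEFINITE plane), where the orbit map is still proper (compact centraliser,
★ p839953 `isCompact_setOf_exists_conj_circleDiagonal_mem_of_blocks`).  This file proves (h2)∕(h4) under the honest hypothesis «the orbit map of `diag(z_w)` is proper at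
every place» and supplies that hypothesis at regular places and at compact split walls.

WHAT IS PROVED.
* §1 `isCompact_setOf_conj_archDiagTorus_mem_of_forall_place`, `hasCompactSupport_comp_conj_archDiagTorus_of_forall_place` — GLOBAL properness of `g ↦ g·t(z)·g⁻¹` from
  PER-PLACE properness of `g_w ↦ g_w·diag(z_w)·g_w⁻¹` (through ★ `archPiEquivCM`, ★ `archPiEquivCM_archDiagTorus`).
* §2 `integral_comp_conj_archDiagTorus_eq_integral_integral_of_forall_place` ((h2)′) and `integral_comp_conj_archDiagTorus_eq_integral_partial_of_forall_place` ((h4)′):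
  the ★ (V7) statements VERBATIM with `hz` replaced by the per-place properness hypothesis `hprop` (proofs = the ★ ones with §1 in place of ★ global joint properness).
* §3 the hypothesis suppliers: `isCompact_setOf_conj_circleDiagonal_mem_of_injective` (regular `z_w`, ★ `isCompact_setOf_exists_conj_circleDiagonal_mem`) and
  `isCompact_setOf_conj_circleDiagonal_comp_perm_mem_of_compactWall` (`z₀ ∘ ρ₀` with `z₀ 0 = z₀ 2 ≠ z₀ 1` and `0 < re σ_w(α_{ρ₀⁻¹0})·re σ_w(α_{ρ₀⁻¹2})` — the COMPACT wall
  of ★ (δ)'s `if`-branch; ★ `…_of_blocks` with the block labelling `i ↦ (ρ₀ i = 1)`).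
* §4 `integral_partialOrbital_comp_conj_eq_integral_comp_conj_archDiagTorus_of_compactWall` — THE (δ8) CONVERSION in ★ (δ)'s tokens: at a compact `w`-wall of `ρ_w`,
  `∫_{G_w} PO_{z∘ρ}(x·diag(z w ∘ ρ w)·x⁻¹) dν = ∫_{G′_∞} Θ ↑↑(g·t(z∘ρ)·g⁻¹) dν_∞` — the regular terms of ★ `exists_tendsto_deriv_sin_mul_archStableOrbitalIntegral_update_splitCurve`
  ARE global group integrals of `Θ` at the singular point (quotient-free, the currency of ★ (j2-rep)).
HONEST LABEL: HC_CM is proved only modulo the 7 printed citations until rung 0 closes; this file is measure-theoretic bookkeeping and pays nothing by itself.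

## References
* [BorelJacquet1979] A. Borel, H. Jacquet, *Automorphic forms and automorphic representations*, PSPM 33.1 (1979), §4.1 (`G_∞ = Π_v G(F_v)`, product measures).
* [Rogawski1990] J. D. Rogawski, *Automorphic Representations of Unitary Groups in Three Variables*, Ann. of Math. Stud. 123 (1990), §8.2 p. 122–124, §8.3 p. 122
  (orbital integrals near singular points of the compact Cartan; compact centralisers).
* [DeitmarEchterhoff2014] A. Deitmar, S. Echterhoff, *Principles of Harmonic Analysis*, 2nd ed. (2014), Lemma 9.3.3 (orbital integrals of `C_c` functions).
-/

set_option autoImplicit false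

noncomputable section

open MeasureTheory Measure Matrix NumberField NumberField.InfinitePlace NumberField.mixedEmbedding Set Function Topology Equiv
open scoped MatrixGroups

namespace Literature.NumberTheory.Automorphic.UnitaryGroup

open Literature.LinearAlgebra.Matrix Literature.NumberTheory.Rogawski1990

section General

variable (L : Type) [Field L] [NumberField L] [IsCMField L] (N : ℕ) (α : Fin N → L)

/-! ## §1 Global properness of the orbit map from per-place properness -/

/-- **GLOBAL PROPERNESS FROM PER-PLACE PROPERNESS**: if at every place `w` the orbit map `g_w ↦ g_w·diag(z_w)·g_w⁻¹` of `G_w` is proper (preimages of compact sets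
compact), then so is `g ↦ g·t(z)·g⁻¹` on `G′_∞` (★ `archPiEquivCM`, ★ `archPiEquivCM_archDiagTorus`): `{g | g·t(z)·g⁻¹ ∈ C}` is closed and lies in the preimage of the
product of the per-place compact sets. [cite: BorelJacquet1979, §4.1] [cite: Rogawski1990, §8.3 p. 122] [cite: DeitmarEchterhoff2014, Lemma 9.3.3] -/
theorem isCompact_setOf_conj_archDiagTorus_mem_of_forall_place (z : {w : InfinitePlace L // IsComplex w} → Fin N → Circle)
    (hprop : ∀ (w : {w : InfinitePlace L // IsComplex w}) (C : Set (archLocal L N (Matrix.diagonal α) w)), IsCompact C →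
      IsCompact {g : archLocal L N (Matrix.diagonal α) w | g * ⟨circleDiagonal N (z w), circleDiagonal_mem_archLocal_diagonal L N α w (z w)⟩ * g⁻¹ ∈ C})
    {C : Set (arch (↥(maximalRealSubfield L)) L (IsCMField.complexConj L) N (Matrix.diagonal α))} (hC : IsCompact C) :
    IsCompact {g : arch (↥(maximalRealSubfield L)) L (IsCMField.complexConj L) N (Matrix.diagonal α) | g * archDiagTorus L N α z * g⁻¹ ∈ C} := by
  -- the compact box: preimage under `e` of the product of the per-place preimages of the projections of `C`
  have hSw : ∀ w : {w : InfinitePlace L // IsComplex w}, IsCompact {gw : archLocal L N (Matrix.diagonal α) w |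
      gw * ⟨circleDiagonal N (z w), circleDiagonal_mem_archLocal_diagonal L N α w (z w)⟩ * gw⁻¹ ∈ (fun x => archPiEquivCM N L (Matrix.diagonal α) x w) '' C} :=
    fun w => hprop w _ (hC.image ((continuous_apply w).comp (archPiEquivCM N L (Matrix.diagonal α)).continuous))
  have hBc := (isCompact_univ_pi hSw).image (archPiEquivCM N L (Matrix.diagonal α)).symm.continuous
  refine hBc.of_isClosed_subset (hC.isClosed.preimage ((continuous_id.mul continuous_const).mul continuous_id.inv)) fun g hg => ?_
  have hpi : archPiEquivCM N L (Matrix.diagonal α) g ∈ Set.univ.pi fun w => {gw : archLocal L N (Matrix.diagonal α) w |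
      gw * ⟨circleDiagonal N (z w), circleDiagonal_mem_archLocal_diagonal L N α w (z w)⟩ * gw⁻¹ ∈ (fun x => archPiEquivCM N L (Matrix.diagonal α) x w) '' C} := by
    simp only [Set.mem_univ_pi, Set.mem_setOf_eq]
    intro w
    have hw : archPiEquivCM N L (Matrix.diagonal α) (g * archDiagTorus L N α z * g⁻¹) w =
        archPiEquivCM N L (Matrix.diagonal α) g w * ⟨circleDiagonal N (z w), circleDiagonal_mem_archLocal_diagonal L N α w (z w)⟩ *
          (archPiEquivCM N L (Matrix.diagonal α) g w)⁻¹ := by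
      rw [map_mul, map_mul, map_inv, Pi.mul_apply, Pi.mul_apply, Pi.inv_apply, archPiEquivCM_archDiagTorus]
    rw [← hw]
    exact Set.mem_image_of_mem (fun x => archPiEquivCM N L (Matrix.diagonal α) x w) hg
  have hg' := Set.mem_image_of_mem (archPiEquivCM N L (Matrix.diagonal α)).symm hpi
  rwa [ContinuousMulEquiv.symm_apply_apply] at hg'

/-- Compact support of `g ↦ f(g·t(z)·g⁻¹)` on `G′_∞` when the orbit map of `diag(z_w)` is proper at every place. [cite: Rogawski1990, §8.3 p. 122]
[cite: DeitmarEchterhoff2014, Lemma 9.3.3] -/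
theorem hasCompactSupport_comp_conj_archDiagTorus_of_forall_place (z : {w : InfinitePlace L // IsComplex w} → Fin N → Circle)
    (hprop : ∀ (w : {w : InfinitePlace L // IsComplex w}) (C : Set (archLocal L N (Matrix.diagonal α) w)), IsCompact C →
      IsCompact {g : archLocal L N (Matrix.diagonal α) w | g * ⟨circleDiagonal N (z w), circleDiagonal_mem_archLocal_diagonal L N α w (z w)⟩ * g⁻¹ ∈ C})
    {E : Type*} [Zero E] (f : arch (↥(maximalRealSubfield L)) L (IsCMField.complexConj L) N (Matrix.diagonal α) → E) (hfc : HasCompactSupport f) :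
    HasCompactSupport fun g : arch (↥(maximalRealSubfield L)) L (IsCMField.complexConj L) N (Matrix.diagonal α) => f (g * archDiagTorus L N α z * g⁻¹) := by
  refine HasCompactSupport.intro (isCompact_setOf_conj_archDiagTorus_mem_of_forall_place L N α z hprop hfc.isCompact) fun g hg => ?_
  exact image_eq_zero_of_notMem_tsupport hg

/-! ## §2 (h2)′ and (h4)′: Fubini at one place under per-place properness -/

variable [MeasurableSpace (arch (↥(maximalRealSubfield L)) L (IsCMField.complexConj L) N (Matrix.diagonal α))] [BorelSpace (arch (↥(maximalRealSubfield L)) L (IsCMField.complexConj L) N (Matrix.diagonal α))]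
  [∀ w : {w : InfinitePlace L // IsComplex w}, MeasurableSpace (archLocal L N (Matrix.diagonal α) w)]
  [∀ w : {w : InfinitePlace L // IsComplex w}, BorelSpace (archLocal L N (Matrix.diagonal α) w)]
  [∀ w : {w : InfinitePlace L // IsComplex w}, SecondCountableTopology (archLocal L N (Matrix.diagonal α) w)]
  [∀ w : {w : InfinitePlace L // IsComplex w}, LocallyCompactSpace (archLocal L N (Matrix.diagonal α) w)]

open scoped Classical in
/-- **(h2)′ FUBINI AT ONE PLACE `w₀` under per-place properness** — ★ (h2) `integral_comp_conj_archDiagTorus_eq_integral_integral` verbatim with the regularity `hz`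
replaced by `hprop` (the proof is the ★ one with §1 in place of ★ global joint properness). [cite: BorelJacquet1979, §4.1] [cite: Rogawski1990, §8.3 p. 122] -/
theorem integral_comp_conj_archDiagTorus_eq_integral_integral_of_forall_place {E : Type*} [NormedAddCommGroup E] [NormedSpace ℝ E]
    (νw : ∀ w : {w : InfinitePlace L // IsComplex w}, Measure (archLocal L N (Matrix.diagonal α) w)) [∀ w, (νw w).IsHaarMeasure]
    (w₀ : {w : InfinitePlace L // IsComplex w}) (f : arch (↥(maximalRealSubfield L)) L (IsCMField.complexConj L) N (Matrix.diagonal α) → E) (hf : Continuous f) (hfc : HasCompactSupport f)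
    (z : {w : InfinitePlace L // IsComplex w} → Fin N → Circle)
    (hprop : ∀ (w : {w : InfinitePlace L // IsComplex w}) (C : Set (archLocal L N (Matrix.diagonal α) w)), IsCompact C →
      IsCompact {g : archLocal L N (Matrix.diagonal α) w | g * ⟨circleDiagonal N (z w), circleDiagonal_mem_archLocal_diagonal L N α w (z w)⟩ * g⁻¹ ∈ C}) :
    ∫ g, f (g * archDiagTorus L N α z * g⁻¹) ∂((Measure.pi νw).map (archPiEquivCM N L (Matrix.diagonal α)).symm) =
      ∫ x : archLocal L N (Matrix.diagonal α) w₀, (∫ b : (∀ w' : {w : {w : InfinitePlace L // IsComplex w} // ¬ w = w₀}, archLocal L N (Matrix.diagonal α) w'.1),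
        f ((archPiEquivCM N L (Matrix.diagonal α)).symm (fun w =>
          (MeasurableEquiv.piEquivPiSubtypeProd (fun w : {w : InfinitePlace L // IsComplex w} => ↥(archLocal L N (Matrix.diagonal α) w)) (· = w₀)).symm
              ((MeasurableEquiv.piUnique fun i : {w : {w : InfinitePlace L // IsComplex w} // w = w₀} => ↥(archLocal L N (Matrix.diagonal α) i.1)).symm x, b) w *
            ⟨circleDiagonal N (z w), circleDiagonal_mem_archLocal_diagonal L N α w (z w)⟩ *
          ((MeasurableEquiv.piEquivPiSubtypeProd (fun w : {w : InfinitePlace L // IsComplex w} => ↥(archLocal L N (Matrix.diagonal α) w)) (· = w₀)).symm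
              ((MeasurableEquiv.piUnique fun i : {w : {w : InfinitePlace L // IsComplex w} // w = w₀} => ↥(archLocal L N (Matrix.diagonal α) i.1)).symm x, b) w)⁻¹))
        ∂(Measure.pi fun w' : {w : {w : InfinitePlace L // IsComplex w} // ¬ w = w₀} => νw w'.1)) ∂(νw w₀) := by
  -- the integrand on `Π_w G_w`
  set F : (∀ w : {w : InfinitePlace L // IsComplex w}, archLocal L N (Matrix.diagonal α) w) → E :=
    fun y => f ((archPiEquivCM N L (Matrix.diagonal α)).symm
      (fun w => y w * ⟨circleDiagonal N (z w), circleDiagonal_mem_archLocal_diagonal L N α w (z w)⟩ * (y w)⁻¹)) with hF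
  rw [integral_comp_conj_archDiagTorus_map_symm_pi L N α νw f z]
  have hFeq : F = (fun g => f (g * archDiagTorus L N α z * g⁻¹)) ∘ (archPiEquivCM N L (Matrix.diagonal α)).symm := by
    funext y
    rw [Function.comp_apply, archPiEquivCM_symm_mul_archDiagTorus_mul_inv]
  have hFc : Continuous F := by
    rw [hFeq]
    exact (hf.comp ((continuous_id.mul continuous_const).mul continuous_inv)).comp (archPiEquivCM N L (Matrix.diagonal α)).symm.continuous
  have hFs : HasCompactSupport F := by
    rw [hFeq]
    exact (hasCompactSupport_comp_conj_archDiagTorus_of_forall_place L N α z hprop f hfc).comp_homeomorph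
      (archPiEquivCM N L (Matrix.diagonal α)).symm.toHomeomorph
  have hFi : Integrable F (Measure.pi νw) := hFc.integrable_of_hasCompactSupport hFs
  have hψ' := measurePreserving_piEquivPiSubtypeProd (fun w => νw w) (· = w₀)
  have h2 := (hψ'.symm.integral_comp' F).symm
  have hFi' : Integrable (fun q => F ((MeasurableEquiv.piEquivPiSubtypeProd
      (fun w : {w : InfinitePlace L // IsComplex w} => ↥(archLocal L N (Matrix.diagonal α) w)) (· = w₀)).symm q)) _ :=
    (hψ'.symm.integrable_comp_emb (MeasurableEquiv.measurableEmbedding _)).mpr hFi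
  rw [show (∫ y, f ((archPiEquivCM N L (Matrix.diagonal α)).symm
      (fun w => y w * ⟨circleDiagonal N (z w), circleDiagonal_mem_archLocal_diagonal L N α w (z w)⟩ * (y w)⁻¹)) ∂(Measure.pi νw)) =
      ∫ y, F y ∂(Measure.pi νw) from rfl, h2, integral_prod _ hFi']
  have hu' : MeasurePreserving (MeasurableEquiv.piUnique fun i : {w : {w : InfinitePlace L // IsComplex w} // w = w₀} => ↥(archLocal L N (Matrix.diagonal α) i.1))
      (@Measure.pi {w : {w : InfinitePlace L // IsComplex w} // w = w₀} (fun i => ↥(archLocal L N (Matrix.diagonal α) i.1))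
        (Subtype.fintype fun x => x = w₀) (fun i => inferInstance) (fun i => νw i.1)) (νw w₀) := by
    convert measurePreserving_piUnique (fun i : {w : {w : InfinitePlace L // IsComplex w} // w = w₀} => νw i.1) <;>
      exact ((default : {w : {w : InfinitePlace L // IsComplex w} // w = w₀}).2).symm
  rw [← hu'.symm.integral_comp']
  rfl

omit [MeasurableSpace (arch (↥(maximalRealSubfield L)) L (IsCMField.complexConj L) N (Matrix.diagonal α))] [BorelSpace (arch (↥(maximalRealSubfield L)) L (IsCMField.complexConj L) N (Matrix.diagonal α))]
  [∀ w : {w : InfinitePlace L // IsComplex w}, BorelSpace (archLocal L N (Matrix.diagonal α) w)]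
  [∀ w : {w : InfinitePlace L // IsComplex w}, SecondCountableTopology (archLocal L N (Matrix.diagonal α) w)]
  [∀ w : {w : InfinitePlace L // IsComplex w}, LocallyCompactSpace (archLocal L N (Matrix.diagonal α) w)] [NumberField L] [IsCMField L] in
open scoped Classical in
/-- Reassembly: conjugating the assembled family `(x, b)` componentwise by `(diag z_w)_w` is the assembled family of the conjugated pieces (the private reassembly step of
★ (V7) (h4), restated over the public ★ `piEquivPiSubtypeProd_symm_apply_dite` ∕ `piUnique_symm_apply_of_eq`). [cite: BorelJacquet1979, §4.1] -/
theorem conj_assemble_eq_assemble_conj (w₀ : {w : InfinitePlace L // IsComplex w}) (x : archLocal L N (Matrix.diagonal α) w₀)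
    (b : ∀ w' : {w : {w : InfinitePlace L // IsComplex w} // ¬ w = w₀}, archLocal L N (Matrix.diagonal α) w'.1) (d : ∀ w : {w : InfinitePlace L // IsComplex w}, archLocal L N (Matrix.diagonal α) w) :
    (fun w => (MeasurableEquiv.piEquivPiSubtypeProd (fun w : {w : InfinitePlace L // IsComplex w} => ↥(archLocal L N (Matrix.diagonal α) w)) (· = w₀)).symm
              ((MeasurableEquiv.piUnique fun i : {w : {w : InfinitePlace L // IsComplex w} // w = w₀} => ↥(archLocal L N (Matrix.diagonal α) i.1)).symm x, b) w * d w * ((MeasurableEquiv.piEquivPiSubtypeProd (fun w : {w : InfinitePlace L // IsComplex w} => ↥(archLocal L N (Matrix.diagonal α) w)) (· = w₀)).symm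
              ((MeasurableEquiv.piUnique fun i : {w : {w : InfinitePlace L // IsComplex w} // w = w₀} => ↥(archLocal L N (Matrix.diagonal α) i.1)).symm x, b) w)⁻¹) =
    (MeasurableEquiv.piEquivPiSubtypeProd (fun w : {w : InfinitePlace L // IsComplex w} => ↥(archLocal L N (Matrix.diagonal α) w)) (· = w₀)).symm
      ((MeasurableEquiv.piUnique fun i : {w : {w : InfinitePlace L // IsComplex w} // w = w₀} => ↥(archLocal L N (Matrix.diagonal α) i.1)).symm
        (x * d w₀ * x⁻¹), fun w' => b w' * d w'.1 * (b w')⁻¹) := by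
  funext w
  rw [piEquivPiSubtypeProd_symm_apply_dite, piEquivPiSubtypeProd_symm_apply_dite]
  by_cases h : w = w₀
  · subst h
    rw [dif_pos rfl, dif_pos rfl]
    erw [piUnique_symm_apply_of_eq (fun j : {w : InfinitePlace L // IsComplex w} => ↥(archLocal L N (Matrix.diagonal α) j)) w x,
      piUnique_symm_apply_of_eq (fun j : {w : InfinitePlace L // IsComplex w} => ↥(archLocal L N (Matrix.diagonal α) j)) w (x * d w * x⁻¹)]
  · rw [dif_neg h, dif_neg h]

open scoped Classical in
/-- **(h4)′ THE GLOBAL TORUS FUNCTION IS THE PER-PLACE TORUS FUNCTION OF THE PARTIAL ORBITAL INTEGRAL, under per-place properness** — ★ (h4)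
`integral_comp_conj_archDiagTorus_eq_integral_partial` verbatim with `hz` replaced by `hprop` (so it applies at a COMPACT wall of `w₀`, §3).
[cite: BorelJacquet1979, §4.1] [cite: Rogawski1990, §8.2 p. 123; §8.3 p. 122] -/
theorem integral_comp_conj_archDiagTorus_eq_integral_partial_of_forall_place {E : Type*} [NormedAddCommGroup E] [NormedSpace ℝ E]
    (νw : ∀ w : {w : InfinitePlace L // IsComplex w}, Measure (archLocal L N (Matrix.diagonal α) w)) [∀ w, (νw w).IsHaarMeasure]
    (w₀ : {w : InfinitePlace L // IsComplex w}) (f : arch (↥(maximalRealSubfield L)) L (IsCMField.complexConj L) N (Matrix.diagonal α) → E) (hf : Continuous f) (hfc : HasCompactSupport f)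
    (z : {w : InfinitePlace L // IsComplex w} → Fin N → Circle)
    (hprop : ∀ (w : {w : InfinitePlace L // IsComplex w}) (C : Set (archLocal L N (Matrix.diagonal α) w)), IsCompact C →
      IsCompact {g : archLocal L N (Matrix.diagonal α) w | g * ⟨circleDiagonal N (z w), circleDiagonal_mem_archLocal_diagonal L N α w (z w)⟩ * g⁻¹ ∈ C}) :
    ∫ g, f (g * archDiagTorus L N α z * g⁻¹) ∂((Measure.pi νw).map (archPiEquivCM N L (Matrix.diagonal α)).symm) =
      ∫ x : archLocal L N (Matrix.diagonal α) w₀,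
        (fun x' : archLocal L N (Matrix.diagonal α) w₀ =>
          ∫ b : (∀ w' : {w : {w : InfinitePlace L // IsComplex w} // ¬ w = w₀}, archLocal L N (Matrix.diagonal α) w'.1),
            f ((archPiEquivCM N L (Matrix.diagonal α)).symm
              ((MeasurableEquiv.piEquivPiSubtypeProd (fun w : {w : InfinitePlace L // IsComplex w} => ↥(archLocal L N (Matrix.diagonal α) w)) (· = w₀)).symm
                ((MeasurableEquiv.piUnique fun i : {w : {w : InfinitePlace L // IsComplex w} // w = w₀} => ↥(archLocal L N (Matrix.diagonal α) i.1)).symm x',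
                  fun w' => b w' * ⟨circleDiagonal N (z w'.1), circleDiagonal_mem_archLocal_diagonal L N α w'.1 (z w'.1)⟩ * (b w')⁻¹)))
            ∂(Measure.pi fun w' : {w : {w : InfinitePlace L // IsComplex w} // ¬ w = w₀} => νw w'.1))
        (x * ⟨circleDiagonal N (z w₀), circleDiagonal_mem_archLocal_diagonal L N α w₀ (z w₀)⟩ * x⁻¹) ∂(νw w₀) := by
  rw [integral_comp_conj_archDiagTorus_eq_integral_integral_of_forall_place L N α νw w₀ f hf hfc z hprop]
  refine integral_congr_ae (Filter.Eventually.of_forall fun x => ?_)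
  refine integral_congr_ae (Filter.Eventually.of_forall fun b => ?_)
  simp only []
  rw [conj_assemble_eq_assemble_conj L N α w₀ x b (fun w => ⟨circleDiagonal N (z w), circleDiagonal_mem_archLocal_diagonal L N α w (z w)⟩)]

/-! ## §3 Per-place properness: regular points and compact split walls -/

omit [NumberField L] [IsCMField L] [MeasurableSpace (arch (↥(maximalRealSubfield L)) L (IsCMField.complexConj L) N (Matrix.diagonal α))] [BorelSpace (arch (↥(maximalRealSubfield L)) L (IsCMField.complexConj L) N (Matrix.diagonal α))]
  [∀ w : {w : InfinitePlace L // IsComplex w}, MeasurableSpace (archLocal L N (Matrix.diagonal α) w)]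
  [∀ w : {w : InfinitePlace L // IsComplex w}, BorelSpace (archLocal L N (Matrix.diagonal α) w)]
  [∀ w : {w : InfinitePlace L // IsComplex w}, SecondCountableTopology (archLocal L N (Matrix.diagonal α) w)]
  [∀ w : {w : InfinitePlace L // IsComplex w}, LocallyCompactSpace (archLocal L N (Matrix.diagonal α) w)] in
/-- At a REGULAR `z_w` the orbit map is proper (★ `isCompact_setOf_exists_conj_circleDiagonal_mem` with `K = {z_w}`). [cite: Rogawski1990, §8.3 p. 122] -/
theorem isCompact_setOf_conj_circleDiagonal_mem_of_injective (w : {w : InfinitePlace L // IsComplex w}) (hα : ∀ i, α i ≠ 0) (u : Fin N → Circle) (hu : Function.Injective u)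
    (C : Set (archLocal L N (Matrix.diagonal α) w)) (hC : IsCompact C) :
    IsCompact {g : archLocal L N (Matrix.diagonal α) w | g * ⟨circleDiagonal N u, circleDiagonal_mem_archLocal_diagonal L N α w u⟩ * g⁻¹ ∈ C} := by
  have h := isCompact_setOf_exists_conj_circleDiagonal_mem L N α w hα isCompact_singleton (Set.singleton_subset_iff.mpr hu) hC
  convert h using 2 with g
  simp only [Set.mem_singleton_iff, exists_eq_left]

end General

/-! ### Compact split walls at a `(2,1)`∕`(1,2)` place (`N = 3`) -/

section Three

variable (L : Type) [Field L] (α : Fin 3 → L) (w : {w : InfinitePlace L // IsComplex w})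

/-- The combinatorics of a split wall: two distinct indices off the distinguished one are `{0, 2}`. [cite: Rogawski1990, §8.2 p. 122] -/
private theorem fin3_pair_eq_of_ne_one (k l : Fin 3) (hkl : k ≠ l) (hk : k ≠ 1) (hl : l ≠ 1) : (k = 0 ∧ l = 2) ∨ (k = 2 ∧ l = 0) := by
  revert k l
  decide

/-- The combinatorics of a split wall: indices separated by the labelling `(· = 1)`. [cite: Rogawski1990, §8.2 p. 122] -/
private theorem fin3_sep_of_decide_ne (k l : Fin 3) (h : decide (k = 1) ≠ decide (l = 1)) :
    (k = 1 ∧ (l = 0 ∨ l = 2)) ∨ (l = 1 ∧ (k = 0 ∨ k = 2)) := by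
  revert k l
  decide

/-- **PROPERNESS AT A COMPACT SPLIT WALL**: for a wall point `z₀` (`z₀ 0 = z₀ 2 ≠ z₀ 1`) and a relabelling `ρ₀` whose wall `{ρ₀⁻¹0, ρ₀⁻¹2}` is COMPACT
(`0 < re σ_w(α_{ρ₀⁻¹0})·re σ_w(α_{ρ₀⁻¹2})` — the `if`-branch of ★ (δ)), the orbit map of `diag(z₀ ∘ ρ₀)` on `G_w` is proper: ★ `isCompact_setOf_exists_conj_circleDiagonal_mem_of_blocks`
with the block labelling `i ↦ (ρ₀ i = 1)` and `K = {z₀ ∘ ρ₀}`. [cite: Rogawski1990, §8.2 p. 122; §8.3 p. 122] [cite: DeitmarEchterhoff2014, Lemma 9.3.3] -/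
theorem isCompact_setOf_conj_circleDiagonal_comp_perm_mem_of_compactWall (hα : ∀ i, α i ≠ 0) (hreal : ∀ i, (w.1.embedding (α i)).im = 0)
    (z₀ : Fin 3 → Circle) (h02 : z₀ 0 = z₀ 2) (h01 : z₀ 0 ≠ z₀ 1) (ρ₀ : Perm (Fin 3))
    (hpos : 0 < (w.1.embedding (α (ρ₀⁻¹ 0))).re * (w.1.embedding (α (ρ₀⁻¹ 2))).re)
    (C : Set (archLocal L 3 (Matrix.diagonal α) w)) (hC : IsCompact C) :
    IsCompact {g : archLocal L 3 (Matrix.diagonal α) w |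
      g * ⟨circleDiagonal 3 (z₀ ∘ ⇑ρ₀), circleDiagonal_mem_archLocal_diagonal L 3 α w (z₀ ∘ ⇑ρ₀)⟩ * g⁻¹ ∈ C} := by
  have hinv : ∀ {i : Fin 3} {k : Fin 3}, ρ₀ i = k → ρ₀⁻¹ k = i := fun {i} {k} h => by
    rw [← h]; exact ρ₀.symm_apply_apply i
  have hsign : ∀ i j : Fin 3, i ≠ j → decide (ρ₀ i = 1) = decide (ρ₀ j = 1) →
      0 < (w.1.embedding (α i)).re * (w.1.embedding (α j)).re := by
    intro i j hij hb
    have hi1 : ρ₀ i ≠ 1 := fun h1 => by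
      have hj1 : ρ₀ j = 1 := by simpa [h1] using hb.symm
      exact hij (ρ₀.injective (h1.trans hj1.symm))
    have hj1 : ρ₀ j ≠ 1 := fun h1 => by
      have hi1' : ρ₀ i = 1 := by simpa [h1] using hb
      exact hi1 hi1'
    rcases fin3_pair_eq_of_ne_one (ρ₀ i) (ρ₀ j) (fun h => hij (ρ₀.injective h)) hi1 hj1 with ⟨hi, hj⟩ | ⟨hi, hj⟩
    · rw [← hinv hi, ← hinv hj]; exact hpos
    · rw [← hinv hi, ← hinv hj, mul_comm]; exact hpos
  have hKsep : ({z₀ ∘ ⇑ρ₀} : Set (Fin 3 → Circle)) ⊆ {z | ∀ i j, decide (ρ₀ i = 1) ≠ decide (ρ₀ j = 1) → z i ≠ z j} := by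
    rintro z rfl i j hb
    simp only [Function.comp_apply]
    rcases fin3_sep_of_decide_ne (ρ₀ i) (ρ₀ j) hb with ⟨hi, hj | hj⟩ | ⟨hj, hi | hi⟩
    · rw [hi, hj]; exact fun h => h01 h.symm
    · rw [hi, hj, ← h02]; exact fun h => h01 h.symm
    · rw [hi, hj]; exact h01
    · rw [hi, hj, ← h02]; exact h01
  have h := isCompact_setOf_exists_conj_circleDiagonal_mem_of_blocks L 3 α w hα hreal (fun i => decide (ρ₀ i = 1)) hsign
    isCompact_singleton hKsep hC
  convert h using 2 with g
  simp only [Set.mem_singleton_iff, exists_eq_left]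

variable [NumberField L] [IsCMField L] [MeasurableSpace (GL (Fin 3) ℂ)] [BorelSpace (GL (Fin 3) ℂ)]
  [MeasurableSpace (arch (↥(maximalRealSubfield L)) L (IsCMField.complexConj L) 3 (Matrix.diagonal α))] [BorelSpace (arch (↥(maximalRealSubfield L)) L (IsCMField.complexConj L) 3 (Matrix.diagonal α))]

/-! ## §4 The (δ8) conversion: the compact-wall regular terms of ★ (δ) are global group integrals -/

open scoped Classical in
/-- **(δ8) — AT A COMPACT `w`-WALL THE REGULAR TERM OF ★ (δ) IS A GLOBAL GROUP INTEGRAL AT THE SINGULAR POINT**: for `z` regular off `w` with `z w` on the split wall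
and a relabelling `ρ` whose `w`-wall is compact, `∫_{G_w} PO_{z∘ρ}(x·diag(z w ∘ ρ w)·x⁻¹) dν = ∫_{G′_∞} Θ ↑↑(g·t(z∘ρ)·g⁻¹) dν_∞` — tokens of ★
`exists_tendsto_deriv_sin_mul_archStableOrbitalIntegral_update_splitCurve` ((h4)′ with §3: regular places ★, the compact wall ★ `…_of_blocks`).
[cite: Rogawski1990, §8.2 p. 123; §8.3 p. 122] [cite: BorelJacquet1979, §4.1] -/
theorem integral_partialOrbital_comp_conj_eq_integral_comp_conj_archDiagTorus_of_compactWall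
    (νw : ∀ v : {w : InfinitePlace L // IsComplex w}, Measure (archLocal L 3 (Matrix.diagonal α) v)) [∀ v, (νw v).IsHaarMeasure]
    (ν : Measure (archLocal L 3 (Matrix.diagonal α) w)) (hνw : νw w = ν)
    (νinf : Measure (arch (↥(maximalRealSubfield L)) L (IsCMField.complexConj L) 3 (Matrix.diagonal α))) (hνinf : νinf = (Measure.pi νw).map (archPiEquivCM 3 L (Matrix.diagonal α)).symm)
    (hα : ∀ i, α i ≠ 0) (hherm : ∀ i, (IsCMField.complexConj L (α i) : L) = α i)
    (Θ : Matrix (Fin 3) (Fin 3) (mixedSpace L) → ℂ) (hΘ : Continuous Θ)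
    (hΘc : HasCompactSupport fun g : arch (↥(maximalRealSubfield L)) L (IsCMField.complexConj L) 3 (Matrix.diagonal α) => Θ ((g : GL (Fin 3) (mixedSpace L)) : Matrix (Fin 3) (Fin 3) (mixedSpace L)))
    (z : {w : InfinitePlace L // IsComplex w} → Fin 3 → Circle) (hz : ∀ v, v ≠ w → Function.Injective (z v)) (h02' : z w 0 = z w 2) (h01' : z w 0 ≠ z w 1)
    (ρ : {w : InfinitePlace L // IsComplex w} → Perm (Fin 3)) (hpos : 0 < (w.1.embedding (α ((ρ w)⁻¹ 0))).re * (w.1.embedding (α ((ρ w)⁻¹ 2))).re) :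
    ∫ g : archLocal L 3 (Matrix.diagonal α) w,
        (fun x' : archLocal L 3 (Matrix.diagonal α) w =>
          ∫ b : (∀ w' : {v : {w : InfinitePlace L // IsComplex w} // ¬ v = w}, archLocal L 3 (Matrix.diagonal α) w'.1),
            Θ ((((archPiEquivCM 3 L (Matrix.diagonal α)).symm
              ((MeasurableEquiv.piEquivPiSubtypeProd (fun v : {w : InfinitePlace L // IsComplex w} => ↥(archLocal L 3 (Matrix.diagonal α) v)) (· = w)).symm
                ((MeasurableEquiv.piUnique fun i : {v : {w : InfinitePlace L // IsComplex w} // v = w} => ↥(archLocal L 3 (Matrix.diagonal α) i.1)).symm x',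
                  fun w' => b w' * ⟨circleDiagonal 3 (z w'.1 ∘ ⇑(ρ w'.1)), circleDiagonal_mem_archLocal_diagonal L 3 α w'.1 (z w'.1 ∘ ⇑(ρ w'.1))⟩ * (b w')⁻¹)) :
                arch (↥(maximalRealSubfield L)) L (IsCMField.complexConj L) 3 (Matrix.diagonal α)) : GL (Fin 3) (mixedSpace L)) : Matrix (Fin 3) (Fin 3) (mixedSpace L))
            ∂(Measure.pi fun w' : {v : {w : InfinitePlace L // IsComplex w} // ¬ v = w} => νw w'.1))
          (g * ⟨circleDiagonal 3 (z w ∘ ⇑(ρ w)), circleDiagonal_mem_archLocal_diagonal L 3 α w (z w ∘ ⇑(ρ w))⟩ * g⁻¹) ∂ν =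
      ∫ g, Θ (((g * archDiagTorus L 3 α (fun v => z v ∘ ⇑(ρ v)) * g⁻¹ : arch (↥(maximalRealSubfield L)) L (IsCMField.complexConj L) 3 (Matrix.diagonal α)) : GL (Fin 3) (mixedSpace L)) : Matrix (Fin 3) (Fin 3) (mixedSpace L)) ∂νinf := by
  haveI : ∀ v : {w : InfinitePlace L // IsComplex w}, LocallyCompactSpace (archLocal L 3 (Matrix.diagonal α) v) := fun v => locallyCompactSpace_archLocal L 3 (Matrix.diagonal α) v
  haveI : ∀ v : {w : InfinitePlace L // IsComplex w}, SecondCountableTopology (archLocal L 3 (Matrix.diagonal α) v) := fun v => secondCountableTopology_archLocal L 3 (Matrix.diagonal α) v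
  have hreal : ∀ i, (w.1.embedding (α i)).im = 0 := fun i => im_embedding_eq_zero_of_complexConj_eq L w (hherm i)
  have hf : Continuous fun g : arch (↥(maximalRealSubfield L)) L (IsCMField.complexConj L) 3 (Matrix.diagonal α) => Θ ((g : GL (Fin 3) (mixedSpace L)) : Matrix (Fin 3) (Fin 3) (mixedSpace L)) :=
    hΘ.comp (Units.continuous_val.comp continuous_subtype_val)
  have hprop : ∀ (v : {w : InfinitePlace L // IsComplex w}) (C : Set (archLocal L 3 (Matrix.diagonal α) v)), IsCompact C →
      IsCompact {g : archLocal L 3 (Matrix.diagonal α) v | g * ⟨circleDiagonal 3 ((fun v => z v ∘ ⇑(ρ v)) v),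
        circleDiagonal_mem_archLocal_diagonal L 3 α v ((fun v => z v ∘ ⇑(ρ v)) v)⟩ * g⁻¹ ∈ C} := by
    intro v C hC
    by_cases hv : v = w
    · subst hv
      exact isCompact_setOf_conj_circleDiagonal_comp_perm_mem_of_compactWall L α v hα hreal (z v) h02' h01' (ρ v) hpos C hC
    · exact isCompact_setOf_conj_circleDiagonal_mem_of_injective L 3 α v hα _ ((hz v hv).comp (ρ v).injective) C hC
  rw [hνinf, integral_comp_conj_archDiagTorus_eq_integral_partial_of_forall_place L 3 α νw w _ hf hΘc (fun v => z v ∘ ⇑(ρ v)) hprop, hνw]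

end Three

end Literature.NumberTheory.Automorphic.UnitaryGroup

end
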